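import Summits.ResolutionOfSingularities.ResolutionOfSingularities.Theorems.EquisingularLiftEquisingularLiftNatCompleteIntersectionLiftProj
import Summits.ResolutionOfSingularities.ResolutionOfSingularities.Theorems.EquisingularLiftEquisingularLiftNatCompleteIntersectionLiftAlgebra
import Literature.AlgebraicGeometry.Resolution.StalkIdealLemmas
import Literature.AlgebraicGeometry.Resolution.SncSaturatedCentre
import Literature.AlgebraicGeometry.Resolution.ProjectiveSpaceRegular
import HarnessLib

/-!
# [OURS · L1 W4.5(b) · EL♮(3)] T-LIFT-CI, part 5 (hKEY EXACTNESS): the ideal sheaf `(f₁,…,f_c)~` of forms cutting `Σ` out TRANSVERSALLY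
# IS the ideal sheaf `𝓘_Σ` of the closed SET `Σ = V₊(f)` — `(f)~ = vanishingIdeal ⟨Σ, _⟩` on `ℙⁿ_k`

Cell `res-hironaka`, rung L, slot W4.5(b); crux **EL♮(3)** (stmt-ResolutionOfSingularities-20148), registered stub `stub_elnat_ciNoseThenPoints`
(res-L1-w45b-lead-2 RESHAPE v6); CUT (L1) T-LIFT-CI of res-D-pv-027 AS res-L1-s36-pv-4. OURS; NOT a statement of any manuscript; AI-written,
weaker than expert review. No definition, no `sorry`, standard axioms. `--supports stmt-ResolutionOfSingularities-20148 --as helper`.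

The nose's hKEY clause (`C.comap (Proj φ) = vanishingIdeal ⟨Σ, hSig⟩`, 051's `horizAt_of_noseThenPoints_closed`) is part 3's base change
`C.comap (Proj φ) = (f)~` composed with this file:

* `eq_vanishingIdeal_support_of_forall_radical_le` — ANY ideal sheaf `I` whose stalks at the points of its support are radical IS the
  ideal sheaf of its support (`Mathlib` `vanishingIdeal_support = radical`; tree `le_of_forall_stalkIdeal_le`, `stalkIdeal_radical`).
* `range_projMap_quotGradedHom` / `support_projIdealSheaf_eq` — the support of the tree's `projIdealSheaf 𝒜 I` is the zero locus
  `{y | I ≤ y}` of the homogeneous ideal (points of `Proj(A/I) → Proj A`), so `supp (f)~ = Σ := {y | ∀ l, f_l ∈ y}` (`support_projIdealSheaf_span`).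
* `stalkIdeal_projIdealSheaf_span_isPrime` — under the stalk-level transversality (J′) at `y` (chart `D₊(x_i) ∋ y`), the stalk `(f)~_y`
  is PRIME: the germs of the `f_l/x_i^{d_l}` are cotangent-independent in the regular local ring `𝒪_{ℙⁿ_k,y}` (tree `isRegular_projectiveSpace`,
  `isPrime_span_image_of_linearIndependent_toCotangent`).
* **`projIdealSheaf_span_eq_vanishingIdeal`** — hence `(f)~ = vanishingIdeal ⟨Σ, _⟩` under (J′); with part 3:
  **`comap_projIdealSheaf_span_eq_vanishingIdeal`** — the hKEY clause `(F̃)~ · 𝒪_{ℙⁿ_k} = 𝓘_Σ`.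

References: R. Hartshorne, *Algebraic Geometry* (1977), II Prop. 5.9, Ex. 3.12, Cor. 5.16 [Hartshorne1977]; H. Matsumura (1986) Thms. 14.2–14.3 [Matsumura1987].
-/

set_option linter.dupNamespace false -- mandated namespace `Summit.<Summit>.<Problem>` of this single-conjunct summit

noncomputable section

open CategoryTheory AlgebraicGeometry TopologicalSpace IsLocalRing
open MvPolynomial HomogeneousLocalization
open Literature.AlgebraicGeometry.Resolution Literature.RingTheory.GradedAlgebra

attribute [local instance] MvPolynomial.gradedAlgebra

namespace Summit.ResolutionOfSingularities.ResolutionOfSingularities.Cruxes.EquisingularLiftNat.Sections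

namespace CILift

universe u

/-! ## An ideal sheaf with radical stalks on its support is the ideal sheaf of its support -/

/-- **Radical stalks ⇒ `I = 𝓘_{supp I}`**: if `√(I_x) ≤ I_x` at every point of the support of the ideal sheaf `I`, then `I` is the
vanishing ideal sheaf of its support (Mathlib `vanishingIdeal_support : 𝓘_{supp I} = √I`; the inclusion `√I ≤ I` is checked on
stalks, tree `le_of_forall_stalkIdeal_le` and `stalkIdeal_radical`; off the support `I_x = ⊤`). [cite: Hartshorne1977, II Cor. 5.16 / Ex. 5.6] -/
theorem eq_vanishingIdeal_support_of_forall_radical_le {X : Scheme.{u}} (I : X.IdealSheafData)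
    (h : ∀ x ∈ I.support, (stalkIdeal I x).radical ≤ stalkIdeal I x) :
    I = Scheme.IdealSheafData.vanishingIdeal I.support := by
  rw [Scheme.IdealSheafData.vanishingIdeal_support]
  refine le_antisymm I.le_radical (le_of_forall_stalkIdeal_le fun x => ?_)
  rw [stalkIdeal_radical]
  by_cases hx : x ∈ I.support
  · exact h x hx
  · rw [(mem_support_iff_stalkIdeal_ne_top I x).not_left.mp hx]
    exact le_top

/-! ## The support of `projIdealSheaf 𝒜 I` is the zero locus of `I` -/

section Support

variable {R A : Type u} [CommRing R] [CommRing A] [Algebra R A] (𝒜 : ℕ → Submodule R A) [GradedAlgebra 𝒜]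

/-- **Points of `Proj(A/I) → Proj A`**: the range of `Proj` of the graded quotient map is the zero locus `{y | I ≤ y}` of the homogeneous
ideal `I` (inverse images of relevant homogeneous primes of `A/I` are exactly the relevant homogeneous primes containing `I`).
[cite: Hartshorne1977, II Prop. 5.9 / Ex. 3.12 (a)] -/
theorem range_projMap_quotGradedHom (I : HomogeneousIdeal 𝒜) :
    Set.range (Proj.map (quotGradedHom 𝒜 I.toIdeal) (irrelevant_quotGrading_le_map 𝒜 I)) =
      {y : Proj 𝒜 | I.toIdeal ≤ y.asHomogeneousIdeal.toIdeal} := by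
  classical
  ext y
  constructor
  · rintro ⟨z, rfl⟩ a ha
    change quotGradedHom 𝒜 I.toIdeal a ∈ z.asHomogeneousIdeal
    rw [quotGradedHom_apply, Ideal.Quotient.eq_zero_iff_mem.mpr ha]
    exact zero_mem _
  · intro hy
    have hsurj := quotGradedHom_surjective 𝒜 I.toIdeal
    have hker : RingHom.ker (quotGradedHom 𝒜 I.toIdeal) ≤ y.asHomogeneousIdeal.toIdeal := by
      rw [ker_quotGradedHom]; exact hy
    have hprime : (y.asHomogeneousIdeal.map (quotGradedHom 𝒜 I.toIdeal)).toIdeal.IsPrime := by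
      rw [HomogeneousIdeal.toIdeal_map]
      haveI := y.isPrime
      exact Ideal.map_isPrime_of_surjective hsurj hker
    have hcomap : ((y.asHomogeneousIdeal.map (quotGradedHom 𝒜 I.toIdeal)).toIdeal).comap
        (quotGradedHom 𝒜 I.toIdeal) = y.asHomogeneousIdeal.toIdeal := by
      rw [HomogeneousIdeal.toIdeal_map, Ideal.comap_map_of_surjective _ hsurj, ← RingHom.ker_eq_comap_bot,
        sup_eq_left.mpr hker]
    refine ⟨⟨y.asHomogeneousIdeal.map (quotGradedHom 𝒜 I.toIdeal), hprime, fun hle => y.not_irrelevant_le ?_⟩, ?_⟩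
    · intro a ha
      have hqa : quotGradedHom 𝒜 I.toIdeal a ∈ HomogeneousIdeal.irrelevant (quotGrading 𝒜 I.toIdeal) := by
        rw [HomogeneousIdeal.mem_irrelevant_iff, quotGradedHom_apply, proj_quotGrading_mk,
          (HomogeneousIdeal.mem_irrelevant_iff 𝒜 a).mp ha, map_zero]
      have h2 : a ∈ ((y.asHomogeneousIdeal.map (quotGradedHom 𝒜 I.toIdeal)).toIdeal).comap (quotGradedHom 𝒜 I.toIdeal) :=
        hle hqa
      rwa [hcomap] at h2
    · apply ProjectiveSpectrum.ext
      apply HomogeneousIdeal.toIdeal_injective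
      change ((y.asHomogeneousIdeal.map (quotGradedHom 𝒜 I.toIdeal)).comap (quotGradedHom 𝒜 I.toIdeal)).toIdeal =
        y.asHomogeneousIdeal.toIdeal
      rw [HomogeneousIdeal.toIdeal_comap, hcomap]

/-- **`supp Ĩ = V₊(I)`**: the support of the tree's `projIdealSheaf 𝒜 I` (the kernel of the closed immersion `Proj(A/I) → Proj A`) is the
zero locus of `I`. [cite: Hartshorne1977, II Prop. 5.9] -/
theorem support_projIdealSheaf_eq (I : HomogeneousIdeal 𝒜) :
    ((projIdealSheaf 𝒜 I).support : Set (Proj 𝒜)) = {y : Proj 𝒜 | I.toIdeal ≤ y.asHomogeneousIdeal.toIdeal} := by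
  haveI := isClosedImmersion_projMap_quotGradedHom 𝒜 I
  rw [projIdealSheaf, Scheme.Hom.support_ker,
    (Proj.map (quotGradedHom 𝒜 I.toIdeal) (irrelevant_quotGrading_le_map 𝒜 I)).isClosedEmbedding.isClosed_range.closure_eq,
    range_projMap_quotGradedHom]

end Support

/-! ## `(f)~` on `ℙⁿ_k`: support `= Σ`, prime stalks under (J′), hence `= 𝓘_Σ` -/

section Span

variable {k : Type} [Field k] {n c : ℕ} (f : Fin c → MvPolynomial (Fin (n + 1)) k) (d : Fin c → ℕ)
  (hf : ∀ l, f l ∈ homogeneousSubmodule (Fin (n + 1)) k (d l))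

/-- **`supp (f)~ = Σ := {y | ∀ l, f_l ∈ y}`.** [cite: Hartshorne1977, II Prop. 5.9] -/
theorem support_projIdealSheaf_span :
    ((projIdealSheaf (homogeneousSubmodule (Fin (n + 1)) k)
        ⟨Ideal.span (Set.range f), isHomogeneous_span_of_forall_mem _ f d hf⟩).support :
          Set (Proj (homogeneousSubmodule (Fin (n + 1)) k))) =
      {y | ∀ l, f l ∈ y.asHomogeneousIdeal} := by
  rw [support_projIdealSheaf_eq]
  ext y
  simp only [Set.mem_setOf_eq]
  change Ideal.span (Set.range f) ≤ y.asHomogeneousIdeal.toIdeal ↔ _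
  rw [Ideal.span_le, Set.range_subset_iff]
  rfl

/-- **Prime stalks under (J′).** At a point `y` of `supp (f)~` admitting a chart `D₊(x_i) ∋ y` on which the germs of the `f_l/x_i^{d_l}`
satisfy «`Σ b_l·germ ∈ 𝔪_y² ⇒ b_l ∈ 𝔪_y`», the stalk `(f)~_y` is a PRIME ideal of the regular local ring `𝒪_{ℙⁿ_k,y}` (cotangent-
independent elements of a regular local ring generate a prime, Matsumura 14.2–14.3; tree `isPrime_span_image_of_linearIndependent_toCotangent`,
`isRegular_projectiveSpace`). [cite: Matsumura1987, Thm. 14.2 with Thm. 14.3] -/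
theorem isPrime_stalkIdeal_projIdealSheaf_span (y : Proj (homogeneousSubmodule (Fin (n + 1)) k))
    (hy : y ∈ ((projIdealSheaf (homogeneousSubmodule (Fin (n + 1)) k)
        ⟨Ideal.span (Set.range f), isHomogeneous_span_of_forall_mem _ f d hf⟩).support :
          Set (Proj (homogeneousSubmodule (Fin (n + 1)) k))))
    (i : Fin (n + 1)) (hyi : y ∈ Proj.basicOpen (homogeneousSubmodule (Fin (n + 1)) k) (X i))
    (hJ : ∀ b : Fin c → (Proj (homogeneousSubmodule (Fin (n + 1)) k)).presheaf.stalk y,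
      ∑ l, b l * ((Proj (homogeneousSubmodule (Fin (n + 1)) k)).presheaf.germ
          (Proj.basicOpen (homogeneousSubmodule (Fin (n + 1)) k) (X i)) y hyi).hom
        ((Proj.awayToSection (homogeneousSubmodule (Fin (n + 1)) k) (X i)).hom
          (mk₁ (homogeneousSubmodule (Fin (n + 1)) k) (X_mem_one' i) (d l) (f l) (hf l))) ∈
        maximalIdeal ((Proj (homogeneousSubmodule (Fin (n + 1)) k)).presheaf.stalk y) ^ 2 →
      ∀ l, b l ∈ maximalIdeal ((Proj (homogeneousSubmodule (Fin (n + 1)) k)).presheaf.stalk y)) :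
    (stalkIdeal (projIdealSheaf (homogeneousSubmodule (Fin (n + 1)) k)
        ⟨Ideal.span (Set.range f), isHomogeneous_span_of_forall_mem _ f d hf⟩) y).IsPrime := by
  haveI : IsRegularLocalRing ((Proj (homogeneousSubmodule (Fin (n + 1)) k)).presheaf.stalk y) :=
    isRegular_projectiveSpace n k y
  have hle := (mem_support_iff_stalkIdeal_le _ y).mp hy
  rw [stalkIdeal_projIdealSheaf_span f d hf i y hyi] at hle ⊢
  set G : Fin c → (Proj (homogeneousSubmodule (Fin (n + 1)) k)).presheaf.stalk y := fun l =>
    ((Proj (homogeneousSubmodule (Fin (n + 1)) k)).presheaf.germ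
        (Proj.basicOpen (homogeneousSubmodule (Fin (n + 1)) k) (X i)) y hyi).hom
      ((Proj.awayToSection (homogeneousSubmodule (Fin (n + 1)) k) (X i)).hom
        (mk₁ (homogeneousSubmodule (Fin (n + 1)) k) (X_mem_one' i) (d l) (f l) (hf l))) with hG
  have hGm : ∀ l, G l ∈ maximalIdeal _ := fun l => hle (Ideal.subset_span ⟨l, rfl⟩)
  have hli := linearIndependent_toCotangent_of_forall_family G hGm hJ
  have h := isPrime_span_image_of_linearIndependent_toCotangent G hGm hli Set.univ
  rwa [Set.image_univ] at h

/-- **hKEY EXACTNESS: `(f)~ = 𝓘_Σ`** on `ℙⁿ_k` (`k` a field): if (J′) holds at every point of `Σ = supp (f)~`, then the ideal sheaf of the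
forms equals the vanishing ideal sheaf of the closed set `Σ = {y | ∀ l, f_l ∈ y}` (for any proof `hSig` that it is closed).
[cite: Hartshorne1977, II Cor. 5.16; Matsumura1987, Thm. 14.2] -/
theorem projIdealSheaf_span_eq_vanishingIdeal
    (hJ : ∀ y ∈ ((projIdealSheaf (homogeneousSubmodule (Fin (n + 1)) k)
        ⟨Ideal.span (Set.range f), isHomogeneous_span_of_forall_mem _ f d hf⟩).support :
          Set (Proj (homogeneousSubmodule (Fin (n + 1)) k))),
      ∃ (i : Fin (n + 1)) (hyi : y ∈ Proj.basicOpen (homogeneousSubmodule (Fin (n + 1)) k) (X i)),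
        ∀ b : Fin c → (Proj (homogeneousSubmodule (Fin (n + 1)) k)).presheaf.stalk y,
          ∑ l, b l * ((Proj (homogeneousSubmodule (Fin (n + 1)) k)).presheaf.germ
              (Proj.basicOpen (homogeneousSubmodule (Fin (n + 1)) k) (X i)) y hyi).hom
            ((Proj.awayToSection (homogeneousSubmodule (Fin (n + 1)) k) (X i)).hom
              (mk₁ (homogeneousSubmodule (Fin (n + 1)) k) (X_mem_one' i) (d l) (f l) (hf l))) ∈
            maximalIdeal ((Proj (homogeneousSubmodule (Fin (n + 1)) k)).presheaf.stalk y) ^ 2 →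
          ∀ l, b l ∈ maximalIdeal ((Proj (homogeneousSubmodule (Fin (n + 1)) k)).presheaf.stalk y))
    (hSig : IsClosed {y : Proj (homogeneousSubmodule (Fin (n + 1)) k) |
      ∀ l, f l ∈ (y : ProjectiveSpectrum (homogeneousSubmodule (Fin (n + 1)) k)).asHomogeneousIdeal}) :
    projIdealSheaf (homogeneousSubmodule (Fin (n + 1)) k)
        ⟨Ideal.span (Set.range f), isHomogeneous_span_of_forall_mem _ f d hf⟩ =
      Scheme.IdealSheafData.vanishingIdeal
        ⟨{y : Proj (homogeneousSubmodule (Fin (n + 1)) k) |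
          ∀ l, f l ∈ (y : ProjectiveSpectrum (homogeneousSubmodule (Fin (n + 1)) k)).asHomogeneousIdeal}, hSig⟩ := by
  have hsupp : (⟨{y : Proj (homogeneousSubmodule (Fin (n + 1)) k) |
      ∀ l, f l ∈ (y : ProjectiveSpectrum (homogeneousSubmodule (Fin (n + 1)) k)).asHomogeneousIdeal}, hSig⟩ :
      Closeds (Proj (homogeneousSubmodule (Fin (n + 1)) k))) =
      (projIdealSheaf (homogeneousSubmodule (Fin (n + 1)) k)
        ⟨Ideal.span (Set.range f), isHomogeneous_span_of_forall_mem _ f d hf⟩).support :=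
    Closeds.ext (support_projIdealSheaf_span f d hf).symm
  rw [hsupp]
  refine eq_vanishingIdeal_support_of_forall_radical_le _ fun y hy => ?_
  obtain ⟨i, hyi, hJy⟩ := hJ y hy
  exact (isPrime_stalkIdeal_projIdealSheaf_span f d hf y hy i hyi hJy).isRadical

end Span

/-! ## The hKEY clause of the nose: `(F̃)~ · 𝒪_{ℙⁿ_k} = 𝓘_Σ` -/

/-- **hKEY for the complete-intersection nose**: with `φ` graded, `φ(x_i) = x_i`, `φ(F̃_l) = f_l` and (J′) at the points of `Σ`:
`(projIdealSheaf 𝒜_O ⟨(F̃),_⟩).comap (Proj.map φ hφ') = vanishingIdeal ⟨Σ, hSig⟩` — part 3's base change followed by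
`projIdealSheaf_span_eq_vanishingIdeal`. This is the `hKEY` input of res-type-051's `horizAt_of_noseThenPoints_closed`.
[cite: Hartshorne1977, II Prop. 5.9, Cor. 5.16] -/
theorem comap_projIdealSheaf_span_eq_vanishingIdeal {O k : Type} [CommRing O] [Field k] {n c : ℕ}
    (φ : (homogeneousSubmodule (Fin (n + 1)) O) →+*ᵍ (homogeneousSubmodule (Fin (n + 1)) k))
    (hφ' : HomogeneousIdeal.irrelevant (homogeneousSubmodule (Fin (n + 1)) k) ≤
      (HomogeneousIdeal.irrelevant (homogeneousSubmodule (Fin (n + 1)) O)).map φ)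
    (hφX : ∀ i : Fin (n + 1), φ (X i) = X i)
    (F : Fin c → MvPolynomial (Fin (n + 1)) O) (f : Fin c → MvPolynomial (Fin (n + 1)) k) (d : Fin c → ℕ)
    (hF : ∀ l, F l ∈ homogeneousSubmodule (Fin (n + 1)) O (d l)) (hf : ∀ l, f l ∈ homogeneousSubmodule (Fin (n + 1)) k (d l))
    (hφF : ∀ l, φ (F l) = f l)
    (hJ : ∀ y : Proj (homogeneousSubmodule (Fin (n + 1)) k), (∀ l, f l ∈ y.asHomogeneousIdeal) →
      ∃ (i : Fin (n + 1)) (hyi : y ∈ Proj.basicOpen (homogeneousSubmodule (Fin (n + 1)) k) (X i)),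
        ∀ b : Fin c → (Proj (homogeneousSubmodule (Fin (n + 1)) k)).presheaf.stalk y,
          ∑ l, b l * ((Proj (homogeneousSubmodule (Fin (n + 1)) k)).presheaf.germ
              (Proj.basicOpen (homogeneousSubmodule (Fin (n + 1)) k) (X i)) y hyi).hom
            ((Proj.awayToSection (homogeneousSubmodule (Fin (n + 1)) k) (X i)).hom
              (mk₁ (homogeneousSubmodule (Fin (n + 1)) k) (X_mem_one' i) (d l) (f l) (hf l))) ∈
            maximalIdeal ((Proj (homogeneousSubmodule (Fin (n + 1)) k)).presheaf.stalk y) ^ 2 →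
          ∀ l, b l ∈ maximalIdeal ((Proj (homogeneousSubmodule (Fin (n + 1)) k)).presheaf.stalk y))
    (hSig : IsClosed {y : Proj (homogeneousSubmodule (Fin (n + 1)) k) |
      ∀ l, f l ∈ (y : ProjectiveSpectrum (homogeneousSubmodule (Fin (n + 1)) k)).asHomogeneousIdeal}) :
    (projIdealSheaf (homogeneousSubmodule (Fin (n + 1)) O)
        ⟨Ideal.span (Set.range F), isHomogeneous_span_of_forall_mem _ F d hF⟩).comap (Proj.map φ hφ') =
      Scheme.IdealSheafData.vanishingIdeal
        ⟨{y : Proj (homogeneousSubmodule (Fin (n + 1)) k) |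
          ∀ l, f l ∈ (y : ProjectiveSpectrum (homogeneousSubmodule (Fin (n + 1)) k)).asHomogeneousIdeal}, hSig⟩ := by
  rw [comap_projIdealSheaf_span φ hφ' hφX F f d hF hf hφF]
  refine projIdealSheaf_span_eq_vanishingIdeal f d hf (fun y hy => hJ y ?_) hSig
  rwa [support_projIdealSheaf_span f d hf] at hy

end CILift

end Summit.ResolutionOfSingularities.ResolutionOfSingularities.Cruxes.EquisingularLiftNat.Sections

end
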